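import Literature.AnabelianGeometry.AbsoluteAnabelian.AbsTopIII.Thm19cCurveLawsProofs
import HarnessLib

/-!
# [AbsTopIII] Prop. 1.6 (iii), kernel form: the PROVABLE half of `Prop_1_6_iii_ker` and
# the unconditional inclusion `P_U ⊆ P_U^{gt}` of Thm. 1.9 (c) (proof-only companion of `KummerPU.lean`)

Mochizuki, *Topics in Absolute Anabelian Geometry III*, §1, Prop. 1.6 (iii) p. 35 ("Suppose that
`U = X ∖ S`, where `S ⊆ X(k)` is a finite subset. Then restricting cohomology classes of `Π_U` to the
various `I_x` for `x ∈ S` yields a natural exact sequence `1 → (k^×)^∧ → H¹(Π_U, M_X) → ⊕_{x ∈ S} Ẑ`")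
and Thm. 1.9 (c) p. 37 ("one constructs the subgroup `P_U ⊆ H¹(Π_U, μ_Ẑ(Π_U))` determined by the cuspidal
principal divisors"), lit key `paper:url-5493eb38cbb7`.  Cell abc-iut, FACT-LIST row F-0378
(`IntrinsicKummerModel.Prop_1_6_iii_ker`, `KummerPU.lean`; abc-iut-f-085).

The named fact `Prop_1_6_iii_ker M` (abc-iut-L4-t1) is the biconditional, for a class
`η ∈ H¹(Π_U, M_X(Ẑ))` over a cofinite open `U ⊆ X` of the model with all cusps rational:
(∀ cusps `c`, `η|_{I_c} = 0`) ⟺ `η ∈ Ker(res_{Δ_U})` (= the Galois classes `H¹(G_k, M_X)`).  It is a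
SCHEMA over the abstract interface `M : IntrinsicKummerModel` (the Kummer map does not enter).  This
PROOF-ONLY file separates its two halves:

* **(⇐) is a theorem for EVERY model** (`IntrinsicKummerModel.prop_1_6_iii_ker_mpr`): a cuspidal
  inertia group lies in `Δ_U` (`CuspidalData.Icusp_eq : I_c = D_c ⊓ Δ_U`), and restriction of continuous
  cohomology to a smaller subgroup factors through restriction to a larger one
  (`cyclotomeModH1Res_of_le`, from Mathlib's `ContinuousCohomology.map_comp`); hence a class vanishing on
  `Δ_U` vanishes on every `I_c`.  No hypothesis of the row (scheme-like, genus, Kummer-faithful,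
  rationality of cusps) is needed for this half.
* **(⇒) is the arithmetic content** (a class unramified at every cusp is a Galois class: in print,
  `Ker(H¹(Π_U, M_X) → ⊕ Ẑ) = H¹(Π_X, M_X) = H¹(G_k, M_X)` because `Hom_{G_k}(Δ_X^{ab}, Ẑ(1)) = T(J_X)^{G_k} = 0`
  over a Kummer-faithful `k`) and is NOT derivable from the interface; `prop_1_6_iii_ker_iff_mp` records
  that the named fact is EQUIVALENT to this half alone (a strictly weaker binder for consumers).

Consequences for the Thm. 1.9 (c) chain (`Thm19PUgtProofs.lean`, `Thm19cProofs.lean`,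
`Thm19cCurveLawsProofs.lean`), whose inclusion `P_U ⊆ P_U^{gt}` consumed only the (⇐) half:
`galoisClasses_subset_PUgt'` (every Galois class has cuspidal degree `0` everywhere — NO hypothesis),
`PU_subset_PUgt_of_kummer'`, and, for every law-abiding `NaturalKummerModel`, `NaturalKummerModel.PU_subset_PUgt`
(**`P_U ⊆ P_U^{gt}` with no named fact**) and `NaturalKummerModel.thm19c_of_mp` (Thm. 1.9 (c) from the (⇒)
half alone).  The reverse inclusion `P_U^{gt} ⊆ P_U` (`PUgt_subset_PU_of_realize`) genuinely uses (⇒).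

All declarations are theorems; no definition, no new fact, frozen files untouched.  HONEST FRAMING: typed ≠ proved for the (⇒) half; nothing here bears on
[IUTchIII] Cor. 3.12.
-/

noncomputable section

open CategoryTheory
open scoped Classical Pointwise

namespace Literature.AnabelianGeometry.AbsoluteAnabelian.AbsTopIII

universe u

/-! ### Restriction to nested subgroups -/

section Restriction

variable {E' E : FundamentalExtension.{u}} (r : E' ⟶ E) (Λ : Type u) [AddCommGroup Λ]
  [TopologicalSpace Λ] [IsTopologicalAddGroup Λ]

/-- **Restriction to a smaller subgroup factors through restriction to a larger one**: for
`I ≤ D ≤ Π_U`, `res_I = res^D_I ∘ res_D` on `H¹(Π_U, M_X(Λ))`, where `res^D_I` is Mathlib's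
`ContinuousCohomology.map` along the continuous inclusion `I ↪ D` (functoriality of continuous cohomology,
`ContinuousCohomology.map_comp`). [cite: MochizukiAbsTopIII2015, Prop 1.6 (iii) p.35] -/
theorem cyclotomeModH1Res_of_le {I D : Subgroup E'.arith} (hle : I ≤ D) :
    cyclotomeModH1Res r Λ I =
      cyclotomeModH1Res r Λ D ≫
        ContinuousCohomology.map.{0, u, u}
          ({ toMonoidHom := Subgroup.inclusion hle
             continuous_toFun := continuous_inclusion hle } : I →ₜ* D) (𝟙 _) 1 := by
  have hφ : (subgroupInclusion D).comp
      ({ toMonoidHom := Subgroup.inclusion hle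
         continuous_toFun := continuous_inclusion hle } : I →ₜ* D) = subgroupInclusion I := by
    ext x
    rfl
  unfold cyclotomeModH1Res
  rw [← ContinuousCohomology.map_comp]
  exact contCohomologyMap_congr hφ.symm _ _ rfl 1

/-- A class of `H¹(Π_U, M_X(Λ))` with vanishing restriction to `D ≤ Π_U` has vanishing restriction to
every `I ≤ D`. [cite: MochizukiAbsTopIII2015, Prop 1.6 (iii) p.35] -/
theorem cyclotomeModH1Res_eq_zero_of_le {I D : Subgroup E'.arith} (hle : I ≤ D)
    (η : cyclotomeModH1 r Λ) (hD : cyclotomeModH1Res r Λ D η = 0) :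
    cyclotomeModH1Res r Λ I η = 0 := by
  rw [cyclotomeModH1Res_of_le r Λ hle]
  change (ContinuousCohomology.map.{0, u, u}
    ({ toMonoidHom := Subgroup.inclusion hle
       continuous_toFun := continuous_inclusion hle } : I →ₜ* D) (𝟙 _) 1).hom
    ((cyclotomeModH1Res r Λ D).hom η) = 0
  rw [show (cyclotomeModH1Res r Λ D).hom η = 0 from hD, map_zero]

end Restriction

/-! ### The (⇐) half of `Prop_1_6_iii_ker`, for every model -/

namespace IntrinsicKummerModel

variable (M : IntrinsicKummerModel.{u})

/-- `η|_D = 0 ⟹ η|_I = 0` for subgroups `I ≤ D ≤ Π_U` and a class `η ∈ H¹(Π_U, M_X)` (model wrapper of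
`cyclotomeModH1Res_eq_zero_of_le`). [cite: MochizukiAbsTopIII2015, Prop 1.6 (iii) p.35] -/
theorem classRes_eq_zero_of_le {U X : M.Curve} (h : M.IsCofiniteOpen U X)
    {I D : Subgroup (M.ext U).arith} (hle : I ≤ D) (η : cyclotomeModH1 (M.res h) ZHatCoeff.{u})
    (hD : M.classRes h D η = 0) : M.classRes h I η = 0 :=
  cyclotomeModH1Res_eq_zero_of_le (M.res h) ZHatCoeff.{u} hle η hD

/-- A cuspidal inertia group lies in `Δ_U` (`I_c = D_c ⋂ Δ_U`). [cite: MochizukiAbsTopIII2015, Prop 1.4 (i) p.31] -/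
theorem icusp_le_geom (U : M.Curve) (c : (M.cusps U).Cusp) :
    (M.cusps U).Icusp c ≤ (M.ext U).geom := by
  rw [(M.cusps U).Icusp_eq c]
  exact inf_le_right

/-- **A Galois class is unramified at every cusp**: if `η ∈ Ker(res_{Δ_U})` then `η|_{I_c} = 0` for every
cusp `c` of `U` — the (⇐) half of Prop. 1.6 (iii) in kernel form, valid for EVERY model and every cofinite
open, with no further hypothesis. [cite: MochizukiAbsTopIII2015, Prop 1.6 (iii) p.35] -/
theorem classRes_icusp_eq_zero_of_mem_galoisClasses {U X : M.Curve} (h : M.IsCofiniteOpen U X)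
    {η : cyclotomeModH1 (M.res h) ZHatCoeff.{u}} (hη : η ∈ M.galoisClasses h)
    (c : (M.cusps U).Cusp) : M.classRes h ((M.cusps U).Icusp c) η = 0 :=
  M.classRes_eq_zero_of_le h (M.icusp_le_geom U c) η ((M.mem_galoisClasses_iff h η).1 hη)

/-- **Prop. 1.6 (iii), kernel form, direction (⇐), for every `M : IntrinsicKummerModel`** — the binder
list of the named fact `Prop_1_6_iii_ker` verbatim, with the biconditional replaced by its (⇐)
implication: a Galois class has vanishing restriction to every cuspidal inertia group.  (FACT-LIST F-0378:
this half is hereby a theorem; the (⇒) half is the residual content, `prop_1_6_iii_ker_iff_mp`.)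
[cite: MochizukiAbsTopIII2015, Prop 1.6 (iii) p.35] -/
theorem prop_1_6_iii_ker_mpr :
    ∀ (U X : M.Curve) (h : M.IsCofiniteOpen U X) (hX : M.IsProper X), M.IsScheme U → M.IsScheme X →
      2 ≤ M.genus X → IsKummerFaithful (M.base U) →
        (∀ c : (M.cusps U).Cusp, (M.cusps U).IsRational c) →
          ∀ η : cyclotomeModH1 (M.res h) ZHatCoeff.{u}, η ∈ M.galoisClasses h →
            ∀ c : (M.cusps U).Cusp, M.classRes h ((M.cusps U).Icusp c) η = 0 := by
  intro U X h _ _ _ _ _ _ η hη c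
  exact M.classRes_icusp_eq_zero_of_mem_galoisClasses h hη c

/-- **SPLIT of the named fact**: `Prop_1_6_iii_ker M` is EQUIVALENT to its (⇒) half alone ("a class
with vanishing restriction to every cuspidal inertia group is a Galois class"), the (⇐) half being a
theorem (`prop_1_6_iii_ker_mpr`).  Consumers may therefore take the displayed strictly weaker hypothesis.
[cite: MochizukiAbsTopIII2015, Prop 1.6 (iii) p.35] -/
theorem prop_1_6_iii_ker_iff_mp :
    M.Prop_1_6_iii_ker ↔
      ∀ (U X : M.Curve) (h : M.IsCofiniteOpen U X) (hX : M.IsProper X), M.IsScheme U → M.IsScheme X →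
        2 ≤ M.genus X → IsKummerFaithful (M.base U) →
          (∀ c : (M.cusps U).Cusp, (M.cusps U).IsRational c) →
            ∀ η : cyclotomeModH1 (M.res h) ZHatCoeff.{u},
              (∀ c : (M.cusps U).Cusp, M.classRes h ((M.cusps U).Icusp c) η = 0) →
                η ∈ M.galoisClasses h := by
  constructor
  · intro hker U X h hX hU hXs hg hk hrat η hη
    exact (hker U X h hX hU hXs hg hk hrat η).1 hη
  · intro hmp U X h hX hU hXs hg hk hrat η
    exact ⟨hmp U X h hX hU hXs hg hk hrat η,
      fun hη c => M.classRes_icusp_eq_zero_of_mem_galoisClasses h hη c⟩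

/-! ### Thm. 1.9 (c): `H¹(G_k, M_Z) ⊆ P_U^{gt}` and `P_U ⊆ P_U^{gt}` without the named fact -/

/-- **`H¹(G_k, M_Z) = Ker(res_{Δ_U}) ⊆ P_U^{gt}`, unconditionally**: every Galois class has cuspidal
degree `0` at every cusp (read through the synchronizations of ANY system of cyclotome presentations `P`)
and the zero divisor is principal — the hypothesis-free form of `galoisClasses_subset_PUgt` (which took
`Prop_1_6_iii_ker` and the hypotheses of Thm. 1.9 (c) but used only the (⇐) half).
[cite: MochizukiAbsTopIII2015, Thm 1.9 (c) p.37] -/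
theorem galoisClasses_subset_PUgt' {U Z : M.Curve} {h : M.IsCofiniteOpen U Z}
    (P : M.toCurveModel.CuspSyncPresentation h) :
    (M.galoisClasses h : Set (cyclotomeModH1 (M.res h) ZHatCoeff.{u})) ⊆ M.PUgt P := by
  intro η hη
  refine ⟨fun _ => 0, fun z => ?_, ?_⟩
  · exact (CurveModel.hasCuspidalDegree_zero_iff P η z).2
      (M.classRes_icusp_eq_zero_of_mem_galoisClasses h hη z)
  · rw [CurveModel.CuspSyncPresentation.cuspidalDivisor_zero]
    exact M.toDivisorCurveModel.isPrincipal_zero Z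

/-- **`P_U ⊆ P_U^{gt}`** from the single explicit input "`κ_U(f) ∈ P_U^{gt}` for every regular unit `f`"
(the degree law (L1)), WITHOUT the named fact `Prop_1_6_iii_ker` — hypothesis-free form of
`PU_subset_PUgt_of_kummer`. [cite: MochizukiAbsTopIII2015, Thm 1.9 (c) p.37] -/
theorem PU_subset_PUgt_of_kummer' {U Z : M.Curve} {h : M.IsCofiniteOpen U Z} (hZ : M.IsProper Z)
    (P : M.toCurveModel.CuspSyncPresentation h)
    (hK : ∀ f : M.regularUnits U, Multiplicative.toAdd (M.kummerMap h hZ f) ∈ M.PUgt P) :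
    (M.PU h hZ : Set (cyclotomeModH1 (M.res h) ZHatCoeff.{u})) ⊆ M.PUgt P := by
  intro η hη
  obtain ⟨a, ha, b, hb, rfl⟩ := AddSubgroup.mem_sup.1 hη
  obtain ⟨f, rfl⟩ := ha
  exact M.add_mem_PUgt P (hK (Additive.toMul f)) (M.galoisClasses_subset_PUgt' P hb)

/-- **`P_U^{gt} = P_U` from the (⇒) half of Prop. 1.6 (iii) and the cuspidal laws** — the form of
`thm19c_of_cuspidalLaws` with the named fact `Prop_1_6_iii_ker` replaced by its strictly weaker (⇒) half
(via `prop_1_6_iii_ker_iff_mp`). [cite: MochizukiAbsTopIII2015, Thm 1.9 (c) p.37] -/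
theorem thm19c_of_mp_of_cuspidalLaws
    (hmp : ∀ (U X : M.Curve) (h : M.IsCofiniteOpen U X) (hX : M.IsProper X), M.IsScheme U →
      M.IsScheme X → 2 ≤ M.genus X → IsKummerFaithful (M.base U) →
        (∀ c : (M.cusps U).Cusp, (M.cusps U).IsRational c) →
          ∀ η : cyclotomeModH1 (M.res h) ZHatCoeff.{u},
            (∀ c : (M.cusps U).Cusp, M.classRes h ((M.cusps U).Icusp c) η = 0) →
              η ∈ M.galoisClasses h)
    (hlaws : ∀ (U Z : M.Curve) (h : M.IsCofiniteOpen U Z) (hZ : M.IsProper Z), M.IsScheme U →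
      M.IsScheme Z → 2 ≤ M.genus Z → IsKummerFaithful (M.base U) →
      (∀ c : (M.cusps U).Cusp, (M.cusps U).IsRational c) →
      ∀ P : M.toCurveModel.CuspSyncPresentation h,
        (∀ f : M.regularUnits U, Multiplicative.toAdd (M.kummerMap h hZ f) ∈ M.PUgt P) ∧
        ∀ D : (M.cusps U).Cusp → ℤ, M.IsPrincipal (P.cuspidalDivisor D) →
          ∃ f : M.regularUnits U,
            ∀ z, CurveModel.HasCuspidalDegree P (Multiplicative.toAdd (M.kummerMap h hZ f)) z (D z)) :
    M.Thm19c :=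
  M.thm19c_of_cuspidalLaws ((M.prop_1_6_iii_ker_iff_mp).2 hmp) hlaws

end IntrinsicKummerModel

/-! ### Law-abiding models: `P_U ⊆ P_U^{gt}` with no named fact -/

namespace NaturalKummerModel

variable (M : NaturalKummerModel.{u})

/-- **`P_U ⊆ P_U^{gt}` for every law-abiding model, with NO named fact**: for a cofinite open `U ⊆ Z` of a
`NaturalKummerModel` with `Z` proper scheme-like of genus `≥ 2` over a Kummer-faithful field and any system
of cyclotome presentations `P`, the model-relative `P_U = κ_U(Γ(U, 𝒪_U^×)) ⊔ Ker(res_{Δ_U})` lies in the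
group-theoretic `P_U^{gt}` — the Kummer half by the degree law (L1) (`kummer_mem_PUgt`), the Galois half by
`galoisClasses_subset_PUgt'`.  One of the two inclusions of Thm. 1.9 (c), now unconditional.
[cite: MochizukiAbsTopIII2015, Thm 1.9 (c) p.37] -/
theorem PU_subset_PUgt {U Z : M.Curve} {h : M.IsCofiniteOpen U Z} (hZ : M.IsProper Z)
    (hZs : M.IsScheme Z) (hg : 2 ≤ M.genus Z) (hk : IsKummerFaithful (M.base U))
    (P : M.toCurveModel.CuspSyncPresentation h) :
    (M.PU h hZ : Set (cyclotomeModH1 (M.res h) ZHatCoeff.{u})) ⊆ M.PUgt P :=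
  M.PU_subset_PUgt_of_kummer' hZ P fun f =>
    M.kummer_mem_PUgt hZ hZs hg (M.isKummerFaithful_base_of_isCofiniteOpen h hk) P f

/-- **Thm. 1.9 (c) for every law-abiding model from the (⇒) half of Prop. 1.6 (iii) alone**: the form of
`NaturalKummerModel.thm19c` with the named fact `Prop_1_6_iii_ker` replaced by its strictly weaker (⇒)
half. [cite: MochizukiAbsTopIII2015, Thm 1.9 (c) p.37] -/
theorem thm19c_of_mp
    (hmp : ∀ (U X : M.Curve) (h : M.IsCofiniteOpen U X) (hX : M.IsProper X), M.IsScheme U →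
      M.IsScheme X → 2 ≤ M.genus X → IsKummerFaithful (M.base U) →
        (∀ c : (M.cusps U).Cusp, (M.cusps U).IsRational c) →
          ∀ η : cyclotomeModH1 (M.res h) ZHatCoeff.{u},
            (∀ c : (M.cusps U).Cusp, M.classRes h ((M.cusps U).Icusp c) η = 0) →
              η ∈ M.galoisClasses h) :
    M.Thm19c :=
  M.thm19c ((M.prop_1_6_iii_ker_iff_mp).2 hmp)

end NaturalKummerModel

end Literature.AnabelianGeometry.AbsoluteAnabelian.AbsTopIII
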